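import Summits.AtomisticToContinuum.BoseEinsteinCondensation.Theses.BECStronglyRayleigh
import Summits.AtomisticToContinuum.BoseEinsteinCondensation.Theorems.BECStronglyRayleighGroundStateStabilitySectorPerron
import Summits.AtomisticToContinuum.BoseEinsteinCondensation.Theorems.InsertionFieldDelocalisation.Negative.PerronExistence
import Literature.MathematicalPhysics.QuantumLattice.LiebMattisSectorPF
import Literature.Probability.LatticeModels.BackboneCurrent
import HarnessLib

/-!
# `SectorGroundStatePerron` (support item stmt-AtomisticToContinuum-9677, route BECStronglyRayleigh):
# Perron–Frobenius in a magnetisation sector of the XY torus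

For `d ≥ 1`, `L ≥ 2`, `N ≤ L^d` the sector `S³_tot = N - L^d/2` of the ferromagnetic spin-½ XY
Hamiltonian `xyTorus d L 1 = xxzHamiltonian 1 (torusGraph d L) (-1) 0` on `(ℤ/Lℤ)^d` (hard-core
bosons, `N` particles = `L^d - N` down spins) contains a nonzero entrywise real-nonnegative vector
`ψ` with `H ψ = E_min(sector) ψ`, and every sector vector with that eigenvalue is a multiple of `ψ`.

Proof (folklore, Perron–Frobenius for stoquastic Hamiltonians; Tasaki (2020) §2.4, Lieb–Wu (2003)
§2): the abstract statement `stoquastic_sector_perronFrobenius` — for a matrix `H` on spin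
configurations with real symmetric entries, nonpositive off the diagonal, zero between different
weights, and nonzero wherever the Heisenberg exchange on a connected graph hops, every nonempty
weight sector carries a nonzero nonnegative ground vector and sector ground vectors are unique up to
scalars — is the compression argument of `LiebMattis.sector_perronFrobenius` without Marshall signs
(`sector_groundState` for existence and the variational bound, `LiebMattis.reflTransGen_subtype`
for ergodicity, `perronFrobenius_groundState_smul_pos/unique`). The entries of the XY Hamiltonian
are those of the field XXZ Hamiltonian at `Δ = 0`, `μ = 0` (`leadPF_entries` of the
`GroundStateStability` line); the torus graph is connected (`torusGraph_reachable_proj`);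
`|(ℤ/Lℤ)^d| = L^d` is `card_torusSite` of `InsertionFieldDelocalisation/Negative/PerronExistence.lean`
(which also proves the existence half by a different route, `|ψ|` of a real sector eigenvector).
-/

noncomputable section

namespace Summit.AtomisticToContinuum.BoseEinsteinCondensation.Theorems.BECStronglyRayleighSectorPerron

open scoped BigOperators Matrix ComplexOrder
open Literature.MathematicalPhysics.QuantumLattice Literature.Probability.LatticeModels
open Matrix Finset Complex

section Abstract

variable {Λ : Type*} [Fintype Λ] [DecidableEq Λ] (n : ℕ) (G : SimpleGraph Λ) [DecidableRel G.Adj]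

/-- **Perron–Frobenius in a weight sector of a stoquastic, weight-preserving spin Hamiltonian.**
Let `H` be a matrix on spin-`n/2` configurations over `Λ` with real symmetric entries, nonpositive
off the diagonal, vanishing between configurations of different weight `Σ_x σ_x`, and nonzero at
every off-diagonal position where the Heisenberg exchange `heisenbergHamiltonian n G 1` of a
connected graph `G` is nonzero (one unit of `Sᶻ` hopped along an edge). Then in every nonempty
weight sector `W` (magnetisation `M = |Λ| n/2 - W`): (1) there is a nonzero, entrywise real
nonnegative `ψ` in the sector with `H ψ = E(M) ψ`, `E(M) = lowestEnergyInSector n H M`; (2) the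
eigenvectors of `H` at `E(M)` in the sector are the multiples of any nonzero one. (Compression of
`H` to the sector is a real symmetric matrix with nonpositive off-diagonal entries and connected
graph, by ergodicity of hops inside a weight sector; abstract Perron–Frobenius for ground states.)
Tasaki (2020) §2.4 (proof of Thm 2.3, without the Marshall sign); Lieb–Wu, Physica A 321 (2003),
§2, items 1–2. [folklore] -/
theorem stoquastic_sector_perronFrobenius (hG : G.Connected) (H : Op Λ (n + 1))
    (hhop : ∀ σ τ : TensorIndex Λ (n + 1), σ ≠ τ → heisenbergHamiltonian n G 1 σ τ ≠ 0 → H σ τ ≠ 0)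
    (hreal : ∀ σ τ : TensorIndex Λ (n + 1), star (H σ τ) = H σ τ)
    (hsymm : ∀ σ τ : TensorIndex Λ (n + 1), H σ τ = H τ σ)
    (hoff : ∀ σ τ : TensorIndex Λ (n + 1), σ ≠ τ → (H σ τ).re ≤ 0)
    (hwt : ∀ σ τ : TensorIndex Λ (n + 1), (∑ z, (σ z : ℕ)) ≠ (∑ z, (τ z : ℕ)) → H σ τ = 0)
    (W : ℕ) (hW : ∃ σ : TensorIndex Λ (n + 1), (∑ z, (σ z : ℕ)) = W) :
    (∃ ψ ∈ spinZSector (Λ := Λ) n (((Fintype.card Λ * n : ℕ) : ℝ) / 2 - W), ψ ≠ 0 ∧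
      (∀ σ, 0 ≤ (ψ σ).re ∧ (ψ σ).im = 0) ∧
      H *ᵥ ψ = ((lowestEnergyInSector n H (((Fintype.card Λ * n : ℕ) : ℝ) / 2 - W) : ℝ) : ℂ) • ψ) ∧
    (∀ ψ φ : TensorIndex Λ (n + 1) → ℂ,
      ψ ∈ spinZSector (Λ := Λ) n (((Fintype.card Λ * n : ℕ) : ℝ) / 2 - W) →
      φ ∈ spinZSector (Λ := Λ) n (((Fintype.card Λ * n : ℕ) : ℝ) / 2 - W) →
      H *ᵥ ψ = ((lowestEnergyInSector n H (((Fintype.card Λ * n : ℕ) : ℝ) / 2 - W) : ℝ) : ℂ) • ψ →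
      H *ᵥ φ = ((lowestEnergyInSector n H (((Fintype.card Λ * n : ℕ) : ℝ) / 2 - W) : ℝ) : ℂ) • φ →
      ψ ≠ 0 → ∃ c : ℂ, φ = c • ψ) := by
  set M : ℝ := ((Fintype.card Λ * n : ℕ) : ℝ) / 2 - W with hMdef
  set K := spinZSector (Λ := Λ) n M with hKdef
  set E : ℝ := lowestEnergyInSector n H M with hEdef
  have hHerm : H.IsHermitian := Matrix.IsHermitian.ext fun σ τ => by rw [hsymm τ σ, hreal]
  have hK : ∀ v, v ∈ K ↔ ∀ σ, ¬(∑ z, (σ z : ℕ)) = W → v σ = 0 :=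
    fun v => LiebMattis.mem_spinZSector_weight_iff n W v
  have hinv : ∀ σ τ : TensorIndex Λ (n + 1), ¬(∑ z, (σ z : ℕ)) = W → (∑ z, (τ z : ℕ)) = W →
      H σ τ = 0 := fun σ τ hσ hτ => hwt σ τ (by rw [hτ]; exact hσ)
  -- (1), (2) of `sector_groundState`: existence of a sector ground vector and the sector bound
  obtain ⟨h1, h2⟩ := sector_groundState H hHerm (fun σ => (∑ z, (σ z : ℕ)) = W) hW hinv K hK
  have hE : H.minEnergyOn K = E := rfl
  rw [hE] at h1 h2
  -- the compression of `H` to the sector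
  set ι := {σ : TensorIndex Λ (n + 1) // (∑ z, (σ z : ℕ)) = W}
  set B : Matrix ι ι ℂ := Matrix.of fun s t => H s.1 t.1 with hBdef
  have hBapply : ∀ s t : ι, B s t = H s.1 t.1 := fun s t => rfl
  have hBreal : ∀ s t : ι, star (B s t) = B s t := fun s t => hreal _ _
  have hBsymm : ∀ s t : ι, B s t = B t s := fun s t => hsymm _ _
  have hBoff : ∀ s t : ι, s ≠ t → (B s t).re ≤ 0 := fun s t hst =>
    hoff _ _ (fun h => hst (Subtype.ext h))
  -- connectivity of the hop graph inside the sector (diagonal steps are irrelevant)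
  have hBaux : ∀ s t : ι, heisenbergHamiltonian n G 1 s.1 t.1 ≠ 0 →
      (Matrix.of fun s t : ι => if s = t then (1 : ℂ) else B s t) s t ≠ 0 := by
    intro s t hst
    by_cases hst' : s = t
    · rw [Matrix.of_apply, if_pos hst']
      exact one_ne_zero
    · rw [Matrix.of_apply, if_neg hst', hBapply]
      exact hhop _ _ (fun h => hst' (Subtype.ext h)) hst
  have hconn : ∀ s t : ι, Relation.ReflTransGen (fun a b => B a b ≠ 0) s t := by
    intro s t
    have h := LiebMattis.reflTransGen_subtype n G 1 hG one_pos W hBaux s t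
    induction h with
    | refl => exact Relation.ReflTransGen.refl
    | @tail b c _ hbc ih =>
      by_cases hbc' : b = c
      · subst hbc'
        exact ih
      · refine ih.tail ?_
        rwa [Matrix.of_apply, if_neg hbc'] at hbc
  -- extension by zero and restriction
  have hext_mem : ∀ v : ι → ℂ,
      (fun σ => if h : (∑ z, (σ z : ℕ)) = W then v ⟨σ, h⟩ else 0) ∈ K := by
    intro v
    rw [hK]
    intro σ hσ
    rw [dif_neg hσ]
  have hdot : ∀ (v : ι → ℂ) (w : TensorIndex Λ (n + 1) → ℂ),
      star (fun σ => if h : (∑ z, (σ z : ℕ)) = W then v ⟨σ, h⟩ else 0) ⬝ᵥ w =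
        star v ⬝ᵥ fun s => w s.1 := by
    intro v w
    rw [dotProduct, dotProduct, sum_eq_sum_subtype_of_support (fun σ => (∑ z, (σ z : ℕ)) = W)]
    · refine Finset.sum_congr rfl fun s _ => ?_
      rw [Pi.star_apply, Pi.star_apply, dif_pos s.2]
    · intro σ hσ
      rw [Pi.star_apply, dif_neg hσ, star_zero, zero_mul]
  have hHext : ∀ (v : ι → ℂ) (s : ι),
      (H *ᵥ fun σ => if h : (∑ z, (σ z : ℕ)) = W then v ⟨σ, h⟩ else 0) s.1 = (B *ᵥ v) s := by
    intro v s
    rw [mulVec, dotProduct, mulVec, dotProduct,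
      sum_eq_sum_subtype_of_support (fun σ => (∑ z, (σ z : ℕ)) = W)]
    · refine Finset.sum_congr rfl fun t _ => ?_
      rw [dif_pos t.2, hBapply, Subtype.coe_eta]
    · intro τ hτ
      rw [dif_neg hτ, mul_zero]
  have hEB : ∀ v : ι → ℂ, E * (star v ⬝ᵥ v).re ≤ (star v ⬝ᵥ B *ᵥ v).re := by
    intro v
    set φ : TensorIndex Λ (n + 1) → ℂ :=
      fun σ => if h : (∑ z, (σ z : ℕ)) = W then v ⟨σ, h⟩ else 0 with hφdef
    have hφφ : star φ ⬝ᵥ φ = star v ⬝ᵥ v := by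
      rw [hφdef, hdot]
      congr 1
      funext s
      rw [dif_pos s.2]
    have hφH : star φ ⬝ᵥ H *ᵥ φ = star v ⬝ᵥ B *ᵥ v := by
      rw [hφdef, hdot]
      congr 1
      funext s
      rw [hHext]
    have := LiebMattis.mul_norm_le_of_unit_bound n H K h2 (hext_mem v)
    rw [hφφ, hφH] at this
    exact this
  have hres : ∀ φ : TensorIndex Λ (n + 1) → ℂ, φ ∈ K → H *ᵥ φ = (E : ℂ) • φ →
      B *ᵥ (fun s : ι => φ s.1) = (E : ℂ) • fun s : ι => φ s.1 := by
    intro φ hφ hHφ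
    funext s
    rw [Pi.smul_apply, smul_eq_mul, mulVec, dotProduct]
    have h := congrFun hHφ s.1
    rw [Pi.smul_apply, smul_eq_mul, mulVec, dotProduct,
      sum_eq_sum_subtype_of_support (fun σ => (∑ z, (σ z : ℕ)) = W)] at h
    · exact h
    · intro τ hτ
      rw [(hK φ).1 hφ τ hτ, mul_zero]
  have hres0 : ∀ φ : TensorIndex Λ (n + 1) → ℂ, φ ∈ K → φ ≠ 0 → (fun s : ι => φ s.1) ≠ 0 := by
    intro φ hφ hφ0 h
    apply hφ0
    funext σ
    by_cases hσ : (∑ z, (σ z : ℕ)) = W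
    · exact congrFun h ⟨σ, hσ⟩
    · exact (hK φ).1 hφ σ hσ
  refine ⟨?_, ?_⟩
  · -- (1) a nonnegative sector ground vector: rephase the one from `sector_groundState`
    obtain ⟨ψ, hψ, hψ0, hHψ⟩ := h1
    obtain ⟨c, hc0, hcpos⟩ := perronFrobenius_groundState_smul_pos hBsymm hBreal hBoff hconn hEB
      (hres ψ hψ hHψ) (hres0 ψ hψ hψ0)
    refine ⟨c • ψ, K.smul_mem c hψ, smul_ne_zero hc0 hψ0, ?_, ?_⟩
    · intro σ
      rw [Pi.smul_apply, smul_eq_mul]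
      by_cases hσ : (∑ z, (σ z : ℕ)) = W
      · obtain ⟨hre, him⟩ := hcpos ⟨σ, hσ⟩
        exact ⟨hre.le, him⟩
      · rw [(hK ψ).1 hψ σ hσ, mul_zero]
        simp
    · rw [mulVec_smul, hHψ, smul_comm]
  · -- (2) uniqueness of sector ground vectors
    intro ψ φ hψ hφ hHψ hHφ hψ0
    obtain ⟨c, hc⟩ := perronFrobenius_groundState_unique hBsymm hBreal hBoff hconn hEB
      (hres ψ hψ hHψ) (hres φ hφ hHφ) (hres0 ψ hψ hψ0)
    refine ⟨c, funext fun σ => ?_⟩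
    by_cases hσ : (∑ z, (σ z : ℕ)) = W
    · have h := congrFun hc ⟨σ, hσ⟩
      simpa only [Pi.smul_apply, smul_eq_mul] using h
    · rw [Pi.smul_apply, smul_eq_mul, (hK ψ).1 hψ σ hσ, (hK φ).1 hφ σ hσ, mul_zero]

end Abstract

/-- **The torus graph `(ℤ/Lℤ)^d` is connected**: every site is the projection of a lattice point
of `ℤ^d`, and projected lattice paths join any two projections (`torusGraph_reachable_proj`).
Friedli–Velenik (2017) §3.1. [folklore] -/
theorem torusGraph_connected (d L : ℕ) : (torusGraph d L).Connected := by
  have hs : Function.Surjective (Torus.proj (d := d) L) := by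
    intro x
    refine ⟨fun i => (ZMod.intCast_surjective (x i)).choose, funext fun i => ?_⟩
    exact (ZMod.intCast_surjective (x i)).choose_spec
  rw [SimpleGraph.connected_iff]
  refine ⟨fun x y => ?_, ⟨fun _ => 0⟩⟩
  obtain ⟨x', rfl⟩ := hs x
  obtain ⟨y', rfl⟩ := hs y
  exact torusGraph_reachable_proj L x' y'

/-- Every weight `W ≤ L^d` is attained by a spin-½ configuration on the torus (the indicator of a
`W`-subset), so the corresponding magnetisation sector is nonempty. [folklore] -/
theorem exists_config_weight_eq (d L : ℕ) [NeZero L] (W : ℕ) (hW : W ≤ L ^ d) :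
    ∃ σ : TensorIndex (TorusSite d L) 2, (∑ z, (σ z : ℕ)) = W := by
  obtain ⟨T, -, hT⟩ := Finset.exists_subset_card_eq (s := (Finset.univ : Finset (TorusSite d L)))
    (n := W) (by rw [Finset.card_univ, InsertionFieldDelocalisation.Negative.card_torusSite]; exact hW)
  refine ⟨fun z => if z ∈ T then 1 else 0, ?_⟩
  have h : ∀ z : TorusSite d L, (((if z ∈ T then 1 else 0 : Fin 2) : ℕ)) = if z ∈ T then 1 else 0 := by
    intro z
    split_ifs <;> rfl
  simp only [h]
  rw [Finset.sum_ite_mem, Finset.univ_inter, Finset.sum_const, smul_eq_mul, mul_one, hT]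

end Summit.AtomisticToContinuum.BoseEinsteinCondensation.Theorems.BECStronglyRayleighSectorPerron

open Literature.MathematicalPhysics.QuantumLattice Literature.Probability.LatticeModels
  Summit.AtomisticToContinuum.BoseEinsteinCondensation.Theorems.BECStronglyRayleighSectorPerron
  Summit.AtomisticToContinuum.BoseEinsteinCondensation.Theorems.InsertionFieldDelocalisation.Negative in
/-- **`SectorGroundStatePerron` (item stmt-AtomisticToContinuum-9677), proved.** For `d ≥ 1`,
`L ≥ 2`, `N ≤ L^d`, the sector `S³_tot = N - L^d/2` of `xyTorus d L 1` (= weight sector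
`W = L^d - N`) contains a nonzero entrywise real-nonnegative `ψ` with `H ψ = E_min(sector) ψ`, and
every sector vector with that eigenvalue is a complex multiple of `ψ`: the XY Hamiltonian has the
entries of the field XXZ Hamiltonian at `Δ = 0`, `μ = 0` (real, symmetric, `-½ ≤ 0` per hop, weight
preserving — `leadPF_entries`), the torus graph is connected, and
`stoquastic_sector_perronFrobenius` applies. Tasaki (2020) §2.4; Kennedy–Lieb–Shastry (1988).
[folklore] -/
theorem Summit.AtomisticToContinuum.BoseEinsteinCondensation.Theorems.SectorGroundStatePerron_proof :
    Summit.AtomisticToContinuum.BoseEinsteinCondensation.Theses.BECStronglyRayleigh.SectorGroundStatePerron := by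
  unfold Summit.AtomisticToContinuum.BoseEinsteinCondensation.Theses.BECStronglyRayleigh.SectorGroundStatePerron
  intro d L _ _ _ N hN
  -- entries of `xyTorus d L 1 = xxzHamiltonian 1 (torusGraph d L) (-1) 0 + Σ_x 0 • S³_x`
  have hent := Summit.AtomisticToContinuum.BoseEinsteinCondensation.Cruxes.GroundStateStability.StableConeVariationalSelection.leadPF_entries
    (torusGraph d L) 0 (fun _ => (0 : ℝ))
  simp only [Complex.ofReal_zero, zero_smul, Finset.sum_const_zero, add_zero] at hent
  obtain ⟨happ, hreal, hsymm, hoff, hwt⟩ := hent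
  have hW : ∃ σ : TensorIndex (TorusSite d L) 2, (∑ z, (σ z : ℕ)) = L ^ d - N :=
    exists_config_weight_eq d L (L ^ d - N) (Nat.sub_le _ _)
  obtain ⟨⟨ψ, hψK, hψ0, hψnn, hHψ⟩, huniq⟩ :=
    stoquastic_sector_perronFrobenius 1 (torusGraph d L) (torusGraph_connected d L) (xyTorus d L 1)
      (fun σ τ hστ h h0 => h (neg_eq_zero.1 ((happ σ τ hστ).symm.trans h0)))
      hreal hsymm hoff hwt (L ^ d - N) hW
  have hM : ((Fintype.card (TorusSite d L) * 1 : ℕ) : ℝ) / 2 - ((L ^ d - N : ℕ) : ℝ) =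
      (N : ℝ) - (L : ℝ) ^ d / 2 := by
    rw [card_torusSite, Nat.cast_sub hN]
    push_cast
    ring
  rw [hM] at hψK hHψ huniq
  exact ⟨ψ, hψ0, hψnn, hψK, hHψ, fun ψ' hψ' hHψ' => huniq ψ ψ' hψK hψ' hHψ hHψ' hψ0⟩
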